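import Summits.QuantumFields.YangMills.Theorems.UnitScaleTiltProp8Chart47Analytic
import Literature.MathematicalPhysics.QuantumFieldTheory.Balaban1983to89.T3ContinuumYM3Torus
import HarnessLib

/-!
# Route `UnitScaleTilt`, crux K1 child «MinimiserStabilityRegPr» (stmt-QuantumFields-19200), registered stub V2′ `stub_halvingStep` — the C_E node's row
# **(S6)∕(X4) «the chart `D(·)` is a holomorphic map», CARRIER EDITION OVER AN ABSTRACT CHART FUNCTIONAL** (★★OWNER RULING g26-№6 (S6), ACK 21 (3)):
# from the two P3a letters of ANY chart functional `Φ` — holomorphy on the weighted ball (hCd) and the quadratic remainder about a continuous linear `Qlin` (hCq) —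
# and a right inverse `H` of `Qlin` with the guarded (46) letter, the analytic selector `D(·)` of `Φ(A′ − H·D) − Qlin(A′ − H·D) = D` with EVERY binder the
# dressing knits display (`hD`, `h49`, `hDd`, `hCd`, (48), (50), (55), (73)) — so that the re-based chart `chartLogFlat` (RULING g26-№6 (S1)∕(S3)) is plugged in
# by ONE `exact` the moment its `hCd♭`∕`hCq♭` land, and the retired single-bar `chartLog` (P3a `chartRemainder_hCd_hCq`) is an instance today

Cell `ym3-torus` (HUMAN RULING D-0037, YM ladder rung R3 — continuum SU(2) YM₃ on the torus is a RUNG, not the Clay problem), width seat `ym-ust-19936-w7`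
gen 2.  `--supports stmt-QuantumFields-19200 --as helper`; def-free, 0 sorry, standard axioms.  Companion of ✓ `…Prop8Chart47Analytic` (p610335∕p610762).

WHAT THIS FILE PROVES (no definition, no sorry; `V` finite-dimensional complex normed, `β` finite; block weight `1`, field weight `w₁ > 0`):
* §1 ★★ `exists_analytic_chartD_of_remainder` — finite `ι`; data: `Φ : (ι → V) → (β → V)`, `Qlin : (ι → V) →L[ℂ] (β → V)`, `H : (β → V) →ₗ[ℂ] (ι → V)`,
  `hΦd : DifferentiableOn ℂ Φ {w₁-ball R}`, `hΦq : size Y ≤ r < R ⇒ ‖Φ Y c − Qlin Y c‖ ≤ C₂r²`, `hHinv : Qlin (H X) = X`, `hHB : 0 ≤ t → ‖X‖_∞ ≤ t ⇒ w₁ i‖H X i‖ ≤ B₀t`,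
  `9C₂B₀ε < 1`, `3ε ≤ R`, `0 < ε`.  Conclusion: `∃ Dsel`, analytic on the `w₁`-ball `< ε` with holomorphic `fderiv`, and — pointwise on the ball — (49) for
  `C := Φ − Qlin`, the ball bound `4C₂ε²`, (48) `Φ(A′ − H·Dsel A′) = Qlin A′`, (50) uniqueness, (55); in the SIZED-FIELD currency `size Y ≤ r < ε` — `hD` ((55),
  negative `r` harmless), `h49` (`∀ᶠ X in 𝓝 Y, Dsel X = C (X − H (Dsel X))`), `hDd`, `hCd` (`DifferentiableAt ℂ C (Y − H (Dsel Y))`); and (73) weighted with the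
  sharp `O(size A′)` constant.  (`Chart47Analytic.exists_analytic_chart47W` + §3∕§5 there at `wB := 1`, `C := Φ − Qlin`.)
* §2 ★★ `exists_analytic_chartD_of_remainder_T3` — the same at the d = 3 carrier `ι := PBond (F.P K) 0` (any `F : T3Family`, `n K`, level weights
  `w : ℕ → PBond (F.P K) 0 → ℝ` with `w 1 > 0`), the four knit binders delivered in the TEXT of ✓ `HalvingDressingLetter.exists_hWq_dressed_cubeSeq_T3`(∕`_of_columnLetters`)
  — i.e. with their gradient-size premiss `w 2 b·L^{K−n}·‖Y(b+e_ν) − Y(b)‖ ≤ r` carried (and not used).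
CARRIER READING (RULING g26-№6 (S6)): `β := BondIdx D`, `Φ := chartLogFlat η D` (✓ `Prop8ChartDoubleBar`, (S1)), `Qlin := fderiv ℂ Φ 0` (= `η·Lʲ·bondAvgIter j`, (S1)'s
certificate), `hΦd`∕`hΦq` := (S3)'s `hCd♭`∕`hCq♭`, `H := flatH`'s ℂ-extension with `hHinv` from ✓`FlatCubeOperators.QE_hOp` and `hHB` from ✓`HSupLetterG`
(★w3-19200 g4's `…FlatHDressingShape`).  Today's instance: `Φ := chartLog η D` with ✓`Prop8Chart.chartRemainder_hCd_hCq` and ✓`ChartHInv.hH_of_flatH` (retired chart).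
HONEST SCOPE.  Bookkeeping over DISPLAYED abstract letters; no estimate of [Balaban1985Variational] asserted; NOT a claim about the stub, the crux, the rung or the gap.

References: T. Bałaban, CMP **102** (1985) 277–309 [Balaban1985Variational] (44)–(50) p.285, (53)–(57) p.286, (63)–(73) pp.287–289, Prop. 3 p.289, (157) p.302.
-/

set_option autoImplicit false

noncomputable section

open Metric Set Filter
open scoped Topology ContDiff

namespace Summit.QuantumFields.YangMills.Theorems.Chart47AnalyticCarrier

open Literature.MathematicalPhysics.QuantumFieldTheory.Balaban1983to89
open T3ContinuumYM3Torus (T3Family)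
open Summit.QuantumFields.YangMills.Theorems.Chart47Analytic

/-! ## §1 Generic index types: the analytic chart from the two remainder letters of an abstract functional -/

section Generic

variable {ι β : Type*} [Fintype ι] [Fintype β] {V : Type*} [NormedAddCommGroup V] [NormedSpace ℂ V] [FiniteDimensional ℂ V]

/-- ★★ **THE ANALYTIC CHART `D(·)` FROM THE REMAINDER LETTERS OF AN ABSTRACT FUNCTIONAL** (see the module docstring for the binders and the list of conclusions).
[cite: Balaban1985Variational, (44)-(50) p.285, (53)-(57) p.286, (63)-(73) pp.287-289, Prop. 3 p.289] -/
theorem exists_analytic_chartD_of_remainder {w₁ : ι → ℝ} (hw₁ : ∀ i, 0 < w₁ i)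
    (Φ : (ι → V) → (β → V)) (Qlin : (ι → V) →L[ℂ] (β → V)) (H : (β → V) →ₗ[ℂ] (ι → V)) {C₂ R B₀ ε : ℝ} (hC₂ : 0 ≤ C₂) (hB₀ : 0 ≤ B₀)
    (hΦd : DifferentiableOn ℂ Φ {Y : ι → V | ∀ i, w₁ i * ‖Y i‖ < R})
    (hΦq : ∀ (Y : ι → V) (r : ℝ), r < R → (∀ i, w₁ i * ‖Y i‖ ≤ r) → ∀ c, ‖Φ Y c - Qlin Y c‖ ≤ C₂ * r ^ 2)
    (hHinv : ∀ X, Qlin (H X) = X)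
    (hHB : ∀ (X : β → V) (t : ℝ), 0 ≤ t → (∀ c, ‖X c‖ ≤ t) → ∀ i, w₁ i * ‖H X i‖ ≤ B₀ * t)
    (hq : 9 * C₂ * B₀ * ε < 1) (hR : 3 * ε ≤ R) (hε : 0 < ε) :
    ∃ Dsel : (ι → V) → (β → V),
      AnalyticOnNhd ℂ Dsel {A' : ι → V | ∀ i, w₁ i * ‖A' i‖ < ε} ∧
      DifferentiableOn ℂ (fderiv ℂ Dsel) {A' : ι → V | ∀ i, w₁ i * ‖A' i‖ < ε} ∧
      -- pointwise on the open ball: ball bound, (49), (48), (50), (55)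
      (∀ A' : ι → V, (∀ i, w₁ i * ‖A' i‖ < ε) →
        (∀ c, ‖Dsel A' c‖ ≤ 4 * C₂ * ε ^ 2) ∧
        Φ (A' - H (Dsel A')) - Qlin (A' - H (Dsel A')) = Dsel A' ∧
        Φ (A' - H (Dsel A')) = Qlin A' ∧
        (∀ D' : β → V, (∀ c, ‖D' c‖ ≤ 4 * C₂ * ε ^ 2) → Φ (A' - H D') - Qlin (A' - H D') = D' → D' = Dsel A') ∧
        (∀ ρ : ℝ, 0 ≤ ρ → (∀ i, w₁ i * ‖A' i‖ ≤ ρ) → ∀ c, ‖Dsel A' c‖ ≤ 4 * C₂ * ρ ^ 2)) ∧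
      -- hD : (55) in the sized-field form
      (∀ (Y : ι → V) (r' : ℝ), r' < ε → (∀ i, w₁ i * ‖Y i‖ ≤ r') → ∀ c, ‖Dsel Y c‖ ≤ 4 * C₂ * r' ^ 2) ∧
      -- h49
      (∀ (Y : ι → V) (r : ℝ), r < ε → (∀ i, w₁ i * ‖Y i‖ ≤ r) →
        ∀ᶠ X in 𝓝 Y, Dsel X = (fun Z : ι → V => Φ Z - Qlin Z) (X - H (Dsel X))) ∧
      -- hDd
      (∀ (Y : ι → V) (r : ℝ), r < ε → (∀ i, w₁ i * ‖Y i‖ ≤ r) → DifferentiableAt ℂ Dsel Y) ∧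
      -- hCd
      (∀ (Y : ι → V) (r : ℝ), r < ε → (∀ i, w₁ i * ‖Y i‖ ≤ r) → DifferentiableAt ℂ (fun Z : ι → V => Φ Z - Qlin Z) (Y - H (Dsel Y))) ∧
      -- (73), weighted, sharp
      (∀ A' : ι → V, (∀ i, w₁ i * ‖A' i‖ < ε) → ∀ ρ : ℝ, 0 ≤ ρ → (∀ i, w₁ i * ‖A' i‖ ≤ ρ) →
        ∀ (W : ι → V) (t : ℝ), 0 ≤ t → (∀ i, w₁ i * ‖W i‖ ≤ t) → ∀ c, ‖fderiv ℂ Dsel A' W c‖ ≤ 9 * C₂ * ρ * (1 - 9 * C₂ * B₀ * ε)⁻¹ * t) := by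
  classical
  set C : (ι → V) → (β → V) := fun Z => Φ Z - Qlin Z with hC
  have hwB : ∀ _c : β, (0 : ℝ) < 1 := fun _ => one_pos
  have hH' : ∀ (X : β → V) (t : ℝ), 0 ≤ t → (∀ c, (fun _ : β => (1 : ℝ)) c * ‖X c‖ ≤ t) → ∀ i, w₁ i * ‖H X i‖ ≤ B₀ * t :=
    fun X t ht hX => hHB X t ht (fun c => by simpa only [one_mul] using hX c)
  have hCq' : ∀ (Y : ι → V) (r : ℝ), r < R → (∀ i, w₁ i * ‖Y i‖ ≤ r) → ∀ c, (fun _ : β => (1 : ℝ)) c * ‖C Y c‖ ≤ C₂ * r ^ 2 :=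
    fun Y r hr hY c => by simpa only [one_mul, hC, Pi.sub_apply] using hΦq Y r hr hY c
  have hCd' : DifferentiableOn ℂ C {Y : ι → V | ∀ i, w₁ i * ‖Y i‖ < R} := hΦd.sub Qlin.differentiable.differentiableOn
  obtain ⟨Dsel, han, hfd, hpt⟩ := exists_analytic_chart47W hw₁ hwB C H hC₂ hB₀ hH' hCq' hCd' hq hR hε
  have hDball : ∀ A' : ι → V, (∀ i, w₁ i * ‖A' i‖ < ε) → ∀ c, (fun _ : β => (1 : ℝ)) c * ‖Dsel A' c‖ ≤ 4 * C₂ * ε ^ 2 :=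
    fun A' hA' => (hpt A' hA').1.1
  have hDfix : ∀ A' : ι → V, (∀ i, w₁ i * ‖A' i‖ < ε) → C (A' - H (Dsel A')) = Dsel A' := fun A' hA' => (hpt A' hA').1.2
  refine ⟨Dsel, han, hfd, fun A' hA' => ⟨fun c => ?_, (hpt A' hA').1.2, ?_, fun D' hD' hfix' => ?_, fun ρ hρ hA'ρ c => ?_⟩, fun Y r' hr' hY => ?_,
    fun Y r hr hY => eventually_fix_of_size_le C H Dsel hDfix Y r hr hY,
    fun Y r hr hY => differentiableAt_chart47W_of_size_le hw₁ hwB C H hC₂ hB₀ hH' hCq' hCd' hq hR hε Dsel hDball hDfix Y r hr hY,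
    fun Y r hr hY => differentiableAt_shift_of_size_le hw₁ C H hC₂ hH' hCd' hq hR hε Dsel hDball Y r hr hY,
    fun A' hA' ρ hρ0 hρ W t ht hW c => ?_⟩
  · simpa only [one_mul] using (hpt A' hA').1.1 c
  · -- (48)
    have h := (hpt A' hA').2.2.2 (Qlin : (ι → V) →ₗ[ℂ] (β → V)) (fun X => by simpa only [ContinuousLinearMap.coe_coe] using hHinv X)
    simp only [ContinuousLinearMap.coe_coe, hC, add_sub_cancel] at h
    exact h
  · -- (50)
    exact (hpt A' hA').2.1 D' (fun c => by simpa only [one_mul] using hD' c) hfix'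
  · -- (55)
    simpa only [one_mul] using (hpt A' hA').2.2.1 ρ hρ hA'ρ c
  · -- hD in the sized-field form
    rcases lt_or_ge r' 0 with hneg | hr0
    · have hι : IsEmpty ι := ⟨fun i => by
        have h0 : 0 ≤ w₁ i * ‖Y i‖ := mul_nonneg (hw₁ i).le (norm_nonneg _)
        linarith [hY i]⟩
      have hY0 : ∀ i, w₁ i * ‖Y i‖ ≤ 0 := fun i => hι.elim i
      intro c
      have h := (hpt Y (mem_wBall_of_size_le hr' hY)).2.2.1 0 le_rfl hY0 c
      have : (0 : ℝ) ≤ 4 * C₂ * r' ^ 2 := by positivity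
      rw [one_mul] at h
      nlinarith
    · exact fun c => by simpa only [one_mul] using (hpt Y (mem_wBall_of_size_le hr' hY)).2.2.1 r' hr0 hY c
  · -- (73)
    simpa only [one_mul] using
      wsize_fderiv_chart47W_le hw₁ hwB C H hC₂ hB₀ hH' hCq' hCd' hq hR hε Dsel hDball hDfix A' hA' ρ hρ0 hρ W t ht hW c

end Generic

/-! ## §2 The d = 3 carrier: the knit binders in their own text (gradient-size premiss carried) -/

section T3

variable {β : Type*} [Fintype β] {V : Type*} [NormedAddCommGroup V] [NormedSpace ℂ V] [FiniteDimensional ℂ V]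

/-- ★★ **THE ANALYTIC CHART `D(·)` AT THE d = 3 CARRIER, KNIT-READY.**  `F : T3Family`, heights `n K`, level weights `w` with `w 1 > 0`; an abstract chart functional
`Φ` on `PBond (F.P K) 0 → V` with block index type `β`, its linear part `Qlin`, a right inverse `H` with the guarded (46) letter, the P3a letters `hΦd`∕`hΦq` and the
window `9C₂B₀ε < 1`, `3ε ≤ R`.  Conclusion: `∃ Dsel` (analytic on the `w 1`-ball `< ε`, holomorphic `fderiv`, (48)–(50)∕(55) pointwise) delivering — with `R := ε`,
`C := fun Z => Φ Z − Qlin Z` — the binders `hD` of ✓`HalvingDressingLetter.exists_hWq_dressed_cubeSeq_T3` and `h49`∕`hDd`∕`hCd` of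
✓`…exists_hWq_dressed_cubeSeq_T3_of_columnLetters` IN THEIR TEXT (sup-size AND gradient-size premisses), plus (73) weighted. [cite: Balaban1985Variational, (44)-(50) p.285, (55) p.286, (73) p.289, Prop. 3 p.289, (157) p.302] -/
theorem exists_analytic_chartD_of_remainder_T3 (F : T3Family) (n K : ℕ) {w : ℕ → PBond (F.P K) 0 → ℝ} (hw1 : ∀ b, 0 < w 1 b)
    (Φ : (PBond (F.P K) 0 → V) → (β → V)) (Qlin : (PBond (F.P K) 0 → V) →L[ℂ] (β → V)) (H : (β → V) →ₗ[ℂ] (PBond (F.P K) 0 → V))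
    {C₂ R B₀ ε : ℝ} (hC₂ : 0 ≤ C₂) (hB₀ : 0 ≤ B₀)
    (hΦd : DifferentiableOn ℂ Φ {Y : PBond (F.P K) 0 → V | ∀ b, w 1 b * ‖Y b‖ < R})
    (hΦq : ∀ (Y : PBond (F.P K) 0 → V) (r : ℝ), r < R → (∀ b, w 1 b * ‖Y b‖ ≤ r) → ∀ c, ‖Φ Y c - Qlin Y c‖ ≤ C₂ * r ^ 2)
    (hHinv : ∀ X, Qlin (H X) = X)
    (hHB : ∀ (X : β → V) (t : ℝ), 0 ≤ t → (∀ c, ‖X c‖ ≤ t) → ∀ b, w 1 b * ‖H X b‖ ≤ B₀ * t)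
    (hq : 9 * C₂ * B₀ * ε < 1) (hR : 3 * ε ≤ R) (hε : 0 < ε) :
    ∃ Dsel : (PBond (F.P K) 0 → V) → (β → V),
      AnalyticOnNhd ℂ Dsel {A' : PBond (F.P K) 0 → V | ∀ b, w 1 b * ‖A' b‖ < ε} ∧
      DifferentiableOn ℂ (fderiv ℂ Dsel) {A' : PBond (F.P K) 0 → V | ∀ b, w 1 b * ‖A' b‖ < ε} ∧
      (∀ A' : PBond (F.P K) 0 → V, (∀ b, w 1 b * ‖A' b‖ < ε) →
        (∀ c, ‖Dsel A' c‖ ≤ 4 * C₂ * ε ^ 2) ∧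
        Φ (A' - H (Dsel A')) - Qlin (A' - H (Dsel A')) = Dsel A' ∧
        Φ (A' - H (Dsel A')) = Qlin A' ∧
        (∀ D' : β → V, (∀ c, ‖D' c‖ ≤ 4 * C₂ * ε ^ 2) → Φ (A' - H D') - Qlin (A' - H D') = D' → D' = Dsel A') ∧
        (∀ ρ : ℝ, 0 ≤ ρ → (∀ b, w 1 b * ‖A' b‖ ≤ ρ) → ∀ c, ‖Dsel A' c‖ ≤ 4 * C₂ * ρ ^ 2)) ∧
      -- hD, knit text
      (∀ (Y : PBond (F.P K) 0 → V) (r' : ℝ), r' < ε → (∀ b, w 1 b * ‖Y b‖ ≤ r') →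
        (∀ (b : PBond (F.P K) 0) (ν : Fin 3), w 2 b * (F.L : ℝ) ^ (K - n) * ‖Y ⟨b.src.shift ν, b.dir⟩ - Y b‖ ≤ r') →
        ∀ c, ‖Dsel Y c‖ ≤ 4 * C₂ * r' ^ 2) ∧
      -- h49, knit text
      (∀ (Y : PBond (F.P K) 0 → V) (r : ℝ), r < ε → (∀ b, w 1 b * ‖Y b‖ ≤ r) →
        (∀ (b : PBond (F.P K) 0) (ν : Fin 3), w 2 b * (F.L : ℝ) ^ (K - n) * ‖Y ⟨b.src.shift ν, b.dir⟩ - Y b‖ ≤ r) →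
        ∀ᶠ X in 𝓝 Y, Dsel X = (fun Z : PBond (F.P K) 0 → V => Φ Z - Qlin Z) (X - H (Dsel X))) ∧
      -- hDd, knit text
      (∀ (Y : PBond (F.P K) 0 → V) (r : ℝ), r < ε → (∀ b, w 1 b * ‖Y b‖ ≤ r) →
        (∀ (b : PBond (F.P K) 0) (ν : Fin 3), w 2 b * (F.L : ℝ) ^ (K - n) * ‖Y ⟨b.src.shift ν, b.dir⟩ - Y b‖ ≤ r) →
        DifferentiableAt ℂ Dsel Y) ∧
      -- hCd, knit text
      (∀ (Y : PBond (F.P K) 0 → V) (r : ℝ), r < ε → (∀ b, w 1 b * ‖Y b‖ ≤ r) →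
        (∀ (b : PBond (F.P K) 0) (ν : Fin 3), w 2 b * (F.L : ℝ) ^ (K - n) * ‖Y ⟨b.src.shift ν, b.dir⟩ - Y b‖ ≤ r) →
        DifferentiableAt ℂ (fun Z : PBond (F.P K) 0 → V => Φ Z - Qlin Z) (Y - H (Dsel Y))) ∧
      -- (73), weighted, sharp
      (∀ A' : PBond (F.P K) 0 → V, (∀ b, w 1 b * ‖A' b‖ < ε) → ∀ ρ : ℝ, 0 ≤ ρ → (∀ b, w 1 b * ‖A' b‖ ≤ ρ) →
        ∀ (W : PBond (F.P K) 0 → V) (t : ℝ), 0 ≤ t → (∀ b, w 1 b * ‖W b‖ ≤ t) →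
          ∀ c, ‖fderiv ℂ Dsel A' W c‖ ≤ 9 * C₂ * ρ * (1 - 9 * C₂ * B₀ * ε)⁻¹ * t) := by
  obtain ⟨Dsel, han, hfd, hpt, hD, h49, hDd, hCd, h73⟩ :=
    exists_analytic_chartD_of_remainder (w₁ := w 1) hw1 Φ Qlin H hC₂ hB₀ hΦd hΦq hHinv hHB hq hR hε
  exact ⟨Dsel, han, hfd, hpt, fun Y r' hr' hY _ => hD Y r' hr' hY, fun Y r hr hY _ => h49 Y r hr hY, fun Y r hr hY _ => hDd Y r hr hY,
    fun Y r hr hY _ => hCd Y r hr hY, h73⟩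

end T3

end Summit.QuantumFields.YangMills.Theorems.Chart47AnalyticCarrier

end
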